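import Literature.MathematicalPhysics.QuantumLattice.HubbardPairEnergyUniform
import Literature.MathematicalPhysics.QuantumLattice.KohnLuttinger
import Literature.Analysis.Fourier.SublevelSetEstimate
import Literature.Analysis.Fourier.SublevelSetSlicing
import HarnessLib

/-!
# The torus sublevel estimate for the pair energy along the band Fermi curve

Topic `Literature/MathematicalPhysics/QuantumLattice`; continues `HubbardPairEnergyUniform`.
For the square-lattice dispersion `ε = squareDispersion 1 0`, level `μ` in a compact sub-band
`[μ₁, μ₂] ⊂ (-4, 0)` and polar point `γ_μ = fermiPolar μ`:

**(TSL)** (`exists_torusSublevel_le`) there are `C ≥ 0` and `β = 1/2` with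
`|{(θ, θ') ∈ (-π, π]² : |ε(p + γ_μ(θ) + γ_μ(θ')) - μ| < s}| ≤ C s^β`
for all `p`, all `s > 0` and all `μ ∈ [μ₁, μ₂]`.

*Proof.* By `exists_uniform_nondegeneracy` there are `c, ℓ > 0` such that on every `ℓ`-box one of
`G, ∂_θG, ∂_φG, ∂²_θG, ∂²_φG, (∂_θ+∂_φ)²G` is `≥ c` in absolute value (`G` the pair energy). Cover
`(-π, π]²` by `N²` grid boxes of side `h = 2π/N ≤ ℓ`. On a box of the first kind the sublevel set is
empty once `s ≤ c`; on the others the one-dimensional sublevel estimates of first and second order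
along the `θ`-, `φ`- or diagonal slices (`Literature.Analysis.Fourier.volume_sublevel_le_of_le_abs_deriv(2)`)
give slices of measure `≤ 6√(s/c)`, hence (`…volume_sublevel_box_le_fst/snd/diag`) a box
contribution `≤ 12 h √(s/c)`. Summing, `≤ 12 N² h √s/√c` for `s ≤ min(c, 1)`, and `4π²` always.

Everything is proved; no definitions. [folklore]
-/

noncomputable section

open Real Set Filter MeasureTheory MeasureTheory.Measure
open scoped Topology ENNReal

namespace Literature.MathematicalPhysics.QuantumLattice

/-! ### The sublevel set in terms of the pair energy -/

/-- `ε(p + γ(θ) + γ(φ)) - μ = pairE μ (p₀, p₁) θ φ`. [folklore] -/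
theorem squareDispersion_pair_eq_pairE (μ : ℝ) (p : Momentum) (θ φ : ℝ) :
    squareDispersion 1 0 (p + (fermiPolar μ θ + fermiPolar μ φ)) - μ = pairE μ (p 0, p 1) θ φ := by
  simp only [squareDispersion, pairE, pairKX, pairKY, bandX, bandY, PiLp.add_apply, fermiPolar_apply_zero,
    fermiPolar_apply_one]
  ring

section Band

variable {μ : ℝ} (hμ₁ : -4 < μ) (hμ₂ : μ < 0)
include hμ₁ hμ₂

/-- The pair energy is jointly continuous in `(θ, φ)`. [folklore] -/
theorem continuous_pairE_uncurry (p : ℝ × ℝ) : Continuous fun z : ℝ × ℝ => pairE μ p z.1 z.2 := by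
  have hu := continuous_bandFermiRadius hμ₁ hμ₂
  unfold pairE pairKX pairKY bandX bandY
  fun_prop

/-- `pairE₁`, `pairE₁₁` are continuous in `θ`; `pairE₂`, `pairE₂₂` in `φ`; and the diagonal
quantities along the diagonal. [folklore] -/
theorem continuous_pairE_derivs (p : ℝ × ℝ) :
    (∀ φ, Continuous fun θ => pairE₁ μ p θ φ) ∧ (∀ φ, Continuous fun θ => pairE₁₁ μ p θ φ) ∧
    (∀ θ, Continuous fun φ => pairE₂ μ p θ φ) ∧ (∀ θ, Continuous fun φ => pairE₂₂ μ p θ φ) ∧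
    (∀ w, Continuous fun u => pairE₁ μ p (w + u) u + pairE₂ μ p (w + u) u) ∧
    (∀ w, Continuous fun u => pairEdd μ p (w + u) u) := by
  have hu := continuous_bandFermiRadius hμ₁ hμ₂
  have hu' := continuous_bandFermiRadiusDeriv hμ₁ hμ₂
  have hu'' := continuous_bandRadiusDeriv2 hμ₁ hμ₂
  refine ⟨fun φ => ?_, fun φ => ?_, fun θ => ?_, fun θ => ?_, fun w => ?_, fun w => ?_⟩ <;>
    simp only [pairEdd, pairE₁, pairE₂, pairE₁₁, pairE₂₂, pairE₁₂, pairKX, pairKY, bandX, bandY, bandVX, bandVY,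
      bandAX, bandAY] <;>
    fun_prop

/-! ### The one-dimensional slice bounds -/

/-- First- or second-order information along `θ`-slices gives slices of measure `≤ 6√(s/c)`
(for `0 < s ≤ c`). [folklore] -/
theorem volume_slice_fst_le (p : ℝ × ℝ) {c s : ℝ} (hc : 0 < c) (hs : 0 < s) (hsc : s ≤ c) {I : Set ℝ}
    (hI : Convex ℝ I) (φ : ℝ)
    (h : (∀ θ ∈ I, c ≤ |pairE₁ μ p θ φ|) ∨ (∀ θ ∈ I, c ≤ |pairE₁₁ μ p θ φ|)) :
    volume {θ ∈ I | |pairE μ p θ φ| < s} ≤ ENNReal.ofReal (6 * Real.sqrt (s / c)) := by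
  obtain ⟨c1, c11, -, -, -, -⟩ := continuous_pairE_derivs hμ₁ hμ₂ p
  have hd1 : ∀ θ ∈ I, HasDerivAt (fun t => pairE μ p t φ) (pairE₁ μ p θ φ) θ :=
    fun θ _ => hasDerivAt_pairE_fst hμ₁ hμ₂ p θ φ
  have hd2 : ∀ θ ∈ I, HasDerivAt (fun t => pairE₁ μ p t φ) (pairE₁₁ μ p θ φ) θ :=
    fun θ _ => hasDerivAt_pairE₁_fst hμ₁ hμ₂ p θ φ
  rcases h with h | h
  · refine (Literature.Analysis.Fourier.volume_sublevel_le_of_le_abs_deriv hI hd1 (c1 φ).continuousOn hc h s).trans ?_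
    refine ENNReal.ofReal_le_ofReal ?_
    -- `2s/c ≤ 6 √(s/c)` as `s/c ≤ 1`
    have hx : s / c ≤ 1 := (div_le_one hc).2 hsc
    have hx0 : 0 ≤ s / c := by positivity
    have hsq : s / c ≤ Real.sqrt (s / c) := by
      conv_lhs => rw [← Real.sqrt_mul_self hx0]
      exact Real.sqrt_le_sqrt (by nlinarith)
    rw [mul_div_assoc]
    linarith
  · exact Literature.Analysis.Fourier.volume_sublevel_le_of_le_abs_deriv2 hI hd1 hd2 (c11 φ).continuousOn hc h hs

/-- The same along `φ`-slices. [folklore] -/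
theorem volume_slice_snd_le (p : ℝ × ℝ) {c s : ℝ} (hc : 0 < c) (hs : 0 < s) (hsc : s ≤ c) {J : Set ℝ}
    (hJ : Convex ℝ J) (θ : ℝ)
    (h : (∀ φ ∈ J, c ≤ |pairE₂ μ p θ φ|) ∨ (∀ φ ∈ J, c ≤ |pairE₂₂ μ p θ φ|)) :
    volume {φ ∈ J | |pairE μ p θ φ| < s} ≤ ENNReal.ofReal (6 * Real.sqrt (s / c)) := by
  obtain ⟨-, -, c2, c22, -, -⟩ := continuous_pairE_derivs hμ₁ hμ₂ p
  have hd1 : ∀ φ ∈ J, HasDerivAt (fun t => pairE μ p θ t) (pairE₂ μ p θ φ) φ :=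
    fun φ _ => hasDerivAt_pairE_snd hμ₁ hμ₂ p θ φ
  have hd2 : ∀ φ ∈ J, HasDerivAt (fun t => pairE₂ μ p θ t) (pairE₂₂ μ p θ φ) φ :=
    fun φ _ => hasDerivAt_pairE₂_snd hμ₁ hμ₂ p θ φ
  rcases h with h | h
  · refine (Literature.Analysis.Fourier.volume_sublevel_le_of_le_abs_deriv hJ hd1 (c2 θ).continuousOn hc h s).trans ?_
    refine ENNReal.ofReal_le_ofReal ?_
    have hx : s / c ≤ 1 := (div_le_one hc).2 hsc
    have hx0 : 0 ≤ s / c := by positivity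
    have hsq : s / c ≤ Real.sqrt (s / c) := by
      conv_lhs => rw [← Real.sqrt_mul_self hx0]
      exact Real.sqrt_le_sqrt (by nlinarith)
    rw [mul_div_assoc]
    linarith
  · exact Literature.Analysis.Fourier.volume_sublevel_le_of_le_abs_deriv2 hJ hd1 hd2 (c22 θ).continuousOn hc h hs

/-- The same along diagonal slices `u ↦ G(w + u, u)`, from the diagonal second derivative. [folklore] -/
theorem volume_slice_diag_le (p : ℝ × ℝ) {c s : ℝ} (hc : 0 < c) (hs : 0 < s) {D : Set ℝ}
    (hD : Convex ℝ D) (w : ℝ) (h : ∀ u ∈ D, c ≤ |pairEdd μ p (w + u) u|) :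
    volume {u ∈ D | |pairE μ p (w + u) u| < s} ≤ ENNReal.ofReal (6 * Real.sqrt (s / c)) := by
  obtain ⟨-, -, -, -, -, cdd⟩ := continuous_pairE_derivs hμ₁ hμ₂ p
  have hd1 : ∀ u ∈ D, HasDerivAt (fun t => pairE μ p (w + t) t) (pairE₁ μ p (w + u) u + pairE₂ μ p (w + u) u) u :=
    fun u _ => hasDerivAt_pairE_diag hμ₁ hμ₂ p w u
  have hd2 : ∀ u ∈ D, HasDerivAt (fun t => pairE₁ μ p (w + t) t + pairE₂ μ p (w + t) t) (pairEdd μ p (w + u) u) u :=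
    fun u _ => hasDerivAt_pairE₁₂_diag hμ₁ hμ₂ p w u
  exact Literature.Analysis.Fourier.volume_sublevel_le_of_le_abs_deriv2 hD hd1 hd2 (cdd w).continuousOn hc h hs

end Band

/-! ### (TSL) -/

/-- **(TSL) The torus sublevel estimate**: for a compact sub-band `[μ₁, μ₂] ⊂ (-4, 0)` there are
`C ≥ 0` and `β = 1/2 ∈ (0, 2)` with
`|{(θ, θ') ∈ (-π,π]² : |ε(p + γ_μ(θ) + γ_μ(θ')) - μ| < s}| ≤ C s^β` for all `p`, `s > 0`,
`μ ∈ [μ₁, μ₂]`. [folklore] -/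
theorem exists_torusSublevel_le {μ₁ μ₂ : ℝ} (h₁ : -4 < μ₁) (h₂ : μ₂ < 0) :
    ∃ C β : ℝ, 0 ≤ C ∧ 0 < β ∧ β < 2 ∧ ∀ μ ∈ Icc μ₁ μ₂, ∀ (p : Momentum) (s : ℝ), 0 < s →
      ((volume.restrict (Ioc (-π) π)).prod (volume.restrict (Ioc (-π) π)))
        {z : ℝ × ℝ | |squareDispersion 1 0 (p + (fermiPolar μ z.1 + fermiPolar μ z.2)) - μ| < s} ≤
        ENNReal.ofReal (C * s ^ β) := by
  obtain ⟨c, ℓ, hc, hℓ, hℓπ, hU⟩ := exists_uniform_nondegeneracy h₁ h₂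
  -- the grid
  set N : ℕ := ⌈2 * π / ℓ⌉₊ with hN
  have hNpos : 0 < N := Nat.ceil_pos.2 (by positivity)
  have hNr : (0 : ℝ) < N := by exact_mod_cast hNpos
  set h : ℝ := 2 * π / N with hh
  have hhpos : 0 < h := by rw [hh]; positivity
  have hNh : 2 * π ≤ N * h := by rw [hh, mul_div_cancel₀ _ hNr.ne']
  have hhℓ : h ≤ ℓ := by
    rw [hh, div_le_iff₀ hNr]
    have h1 : 2 * π / ℓ ≤ N := Nat.le_ceil _
    rw [div_le_iff₀ hℓ] at h1
    linarith
  -- thresholds and constants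
  set s₀ : ℝ := min c 1 with hs₀
  have hs₀pos : 0 < s₀ := lt_min hc one_pos
  set C₁ : ℝ := (N : ℝ) ^ 2 * (12 * h / Real.sqrt c) with hC₁
  set C₂ : ℝ := 4 * π ^ 2 / Real.sqrt s₀ with hC₂
  have hC₁0 : 0 ≤ C₁ := by rw [hC₁]; positivity
  have hC₂0 : 0 ≤ C₂ := by rw [hC₂]; positivity
  refine ⟨max C₁ C₂, 1 / 2, le_max_of_le_left hC₁0, by norm_num, by norm_num, fun μ hμ p s hs => ?_⟩
  have hb : -4 < μ ∧ μ < 0 := ⟨h₁.trans_le hμ.1, hμ.2.trans_lt h₂⟩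
  set pp : ℝ × ℝ := (p 0, p 1) with hpp
  -- the set and the measure
  set ν : Measure (ℝ × ℝ) := (volume.restrict (Ioc (-π) π)).prod (volume.restrict (Ioc (-π) π)) with hν
  set S : Set (ℝ × ℝ) := {z : ℝ × ℝ | |pairE μ pp z.1 z.2| < s} with hSdef
  have hSeq : {z : ℝ × ℝ | |squareDispersion 1 0 (p + (fermiPolar μ z.1 + fermiPolar μ z.2)) - μ| < s} = S := by
    ext z; simp only [mem_setOf_eq, hSdef, squareDispersion_pair_eq_pairE, hpp]
  rw [hSeq]
  have hGc : Continuous fun z : ℝ × ℝ => pairE μ pp z.1 z.2 := continuous_pairE_uncurry hb.1 hb.2 pp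
  have hSm : MeasurableSet S := (isOpen_lt (continuous_abs.comp hGc) continuous_const).measurableSet
  have hνS : ν S = volume (S ∩ Ioc (-π) π ×ˢ Ioc (-π) π) := by
    rw [hν, Measure.prod_restrict, Measure.restrict_apply hSm]; rfl
  rw [hνS]
  have hsqrt : Real.sqrt s = s ^ (1 / 2 : ℝ) := by rw [Real.sqrt_eq_rpow]
  rcases le_or_gt s s₀ with hsmall | hlarge
  · -- small `s`: the grid argument
    have hsc : s ≤ c := hsmall.trans (min_le_left _ _)
    -- the cells
    set a : ℕ → ℝ := fun i => -π + i * h with ha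
    have hamem : ∀ i : ℕ, i < N → a i ∈ Icc (-π) π := by
      intro i hi
      refine ⟨by rw [ha]; simp only; nlinarith [hhpos.le, (Nat.cast_nonneg i : (0:ℝ) ≤ i)], ?_⟩
      rw [ha]; simp only
      have hi' : (i : ℝ) + 1 ≤ N := by exact_mod_cast hi
      have : (i : ℝ) * h ≤ N * h - h := by nlinarith
      have hNh' : (N : ℝ) * h = 2 * π := by rw [hh, mul_div_cancel₀ _ hNr.ne']
      linarith
    -- per-cell bound
    have hcell : ∀ i j : ℕ, i < N → j < N →
        volume (S ∩ Ioc (a i) (a i + h) ×ˢ Ioc (a j) (a j + h)) ≤ ENNReal.ofReal (6 * Real.sqrt (s / c) * (2 * h)) := by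
      intro i j hi hj
      have hW : 0 ≤ 6 * Real.sqrt (s / c) := by positivity
      have haxis : ENNReal.ofReal (6 * Real.sqrt (s / c) * h) ≤ ENNReal.ofReal (6 * Real.sqrt (s / c) * (2 * h)) :=
        ENNReal.ofReal_le_ofReal (by nlinarith)
      -- membership in the `ℓ`-box around the corner
      have hnear : ∀ {x : ℝ} {k : ℕ}, x ∈ Ioc (a k) (a k + h) → |x - a k| ≤ ℓ := fun hx =>
        abs_le.2 ⟨by linarith [hx.1, hhpos], by linarith [hx.2]⟩
      rcases hU μ hμ pp (a i) (hamem i hi) (a j) (hamem j hj) with h0 | hE1 | hE2 | hE11 | hE22 | hEdd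
      · -- `|G| ≥ c ≥ s`: the cell is free of the sublevel set
        have : S ∩ Ioc (a i) (a i + h) ×ˢ Ioc (a j) (a j + h) = ∅ := by
          ext z
          simp only [hSdef, mem_inter_iff, mem_setOf_eq, mem_prod, mem_empty_iff_false, iff_false, not_and]
          intro hz hz1 hz2
          have := h0 z.1 z.2 (hnear hz1) (hnear hz2)
          linarith
        rw [this, measure_empty]; exact bot_le
      · refine (Literature.Analysis.Fourier.volume_sublevel_box_le_fst hGc hW fun φ hφ => ?_).trans haxis
        exact volume_slice_fst_le hb.1 hb.2 pp hc hs hsc (convex_Ioc _ _) φ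
          (Or.inl fun θ hθ => hE1 θ φ (hnear hθ) (hnear hφ))
      · refine (Literature.Analysis.Fourier.volume_sublevel_box_le_snd hGc hW fun θ hθ => ?_).trans haxis
        exact volume_slice_snd_le hb.1 hb.2 pp hc hs hsc (convex_Ioc _ _) θ
          (Or.inl fun φ hφ => hE2 θ φ (hnear hθ) (hnear hφ))
      · refine (Literature.Analysis.Fourier.volume_sublevel_box_le_fst hGc hW fun φ hφ => ?_).trans haxis
        exact volume_slice_fst_le hb.1 hb.2 pp hc hs hsc (convex_Ioc _ _) φ
          (Or.inr fun θ hθ => hE11 θ φ (hnear hθ) (hnear hφ))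
      · refine (Literature.Analysis.Fourier.volume_sublevel_box_le_snd hGc hW fun θ hθ => ?_).trans haxis
        exact volume_slice_snd_le hb.1 hb.2 pp hc hs hsc (convex_Ioc _ _) θ
          (Or.inr fun φ hφ => hE22 θ φ (hnear hθ) (hnear hφ))
      · refine Literature.Analysis.Fourier.volume_sublevel_box_le_diag hGc hW fun w => ?_
        have hDc : Convex ℝ {u : ℝ | w + u ∈ Ioc (a i) (a i + h) ∧ u ∈ Ioc (a j) (a j + h)} := by
          have e : {u : ℝ | w + u ∈ Ioc (a i) (a i + h) ∧ u ∈ Ioc (a j) (a j + h)} =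
              Ioc (a i - w) (a i + h - w) ∩ Ioc (a j) (a j + h) := by
            ext u; simp only [mem_setOf_eq, mem_inter_iff, mem_Ioc]; constructor <;> intro hu <;>
              exact ⟨⟨by linarith [hu.1.1], by linarith [hu.1.2]⟩, hu.2⟩
          rw [e]; exact (convex_Ioc _ _).inter (convex_Ioc _ _)
        have hslice := volume_slice_diag_le hb.1 hb.2 pp hc hs hDc w
          (fun u hu => hEdd (w + u) u (hnear hu.1) (hnear hu.2))
        exact hslice
    -- cover and sum
    have hcover : S ∩ Ioc (-π) π ×ˢ Ioc (-π) π ⊆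
        ⋃ ij ∈ Finset.range N ×ˢ Finset.range N, S ∩ Ioc (a ij.1) (a ij.1 + h) ×ˢ Ioc (a ij.2) (a ij.2 + h) := by
      intro z hz
      obtain ⟨i, hi, hzi⟩ := Literature.Analysis.Fourier.exists_mem_Ioc_grid hhpos hNh hz.2.1
      obtain ⟨j, hj, hzj⟩ := Literature.Analysis.Fourier.exists_mem_Ioc_grid hhpos hNh hz.2.2
      simp only [mem_iUnion, Finset.mem_product, Finset.mem_range, exists_prop, Prod.exists]
      exact ⟨i, j, ⟨hi, hj⟩, hz.1, hzi, hzj⟩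
    calc volume (S ∩ Ioc (-π) π ×ˢ Ioc (-π) π)
        ≤ volume (⋃ ij ∈ Finset.range N ×ˢ Finset.range N,
            S ∩ Ioc (a ij.1) (a ij.1 + h) ×ˢ Ioc (a ij.2) (a ij.2 + h)) := measure_mono hcover
      _ ≤ ∑ ij ∈ Finset.range N ×ˢ Finset.range N,
            volume (S ∩ Ioc (a ij.1) (a ij.1 + h) ×ˢ Ioc (a ij.2) (a ij.2 + h)) := measure_biUnion_finset_le _ _
      _ ≤ ∑ _ij ∈ Finset.range N ×ˢ Finset.range N, ENNReal.ofReal (6 * Real.sqrt (s / c) * (2 * h)) := by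
          refine Finset.sum_le_sum fun ij hij => ?_
          simp only [Finset.mem_product, Finset.mem_range] at hij
          exact hcell ij.1 ij.2 hij.1 hij.2
      _ = ((N : ℝ≥0∞) ^ 2) * ENNReal.ofReal (6 * Real.sqrt (s / c) * (2 * h)) := by
          rw [Finset.sum_const, Finset.card_product, Finset.card_range, nsmul_eq_mul]
          push_cast; ring
      _ = ENNReal.ofReal (C₁ * Real.sqrt s) := by
          rw [hC₁, show ((N : ℝ≥0∞) ^ 2) = ENNReal.ofReal ((N : ℝ) ^ 2) by
            rw [ENNReal.ofReal_pow (Nat.cast_nonneg _), ENNReal.ofReal_natCast], ← ENNReal.ofReal_mul (by positivity)]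
          congr 1
          rw [Real.sqrt_div hs.le]
          have : Real.sqrt c ≠ 0 := (Real.sqrt_pos.2 hc).ne'
          field_simp
          ring
      _ ≤ ENNReal.ofReal (max C₁ C₂ * s ^ (1 / 2 : ℝ)) := by
          rw [← hsqrt]
          exact ENNReal.ofReal_le_ofReal (mul_le_mul_of_nonneg_right (le_max_left _ _) (Real.sqrt_nonneg _))
  · -- large `s`: the whole period box
    calc volume (S ∩ Ioc (-π) π ×ˢ Ioc (-π) π)
        ≤ volume (Ioc (-π) π ×ˢ Ioc (-π) π) := measure_mono inter_subset_right
      _ = ENNReal.ofReal (4 * π ^ 2) := by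
          rw [show (volume : Measure (ℝ × ℝ)) = (volume : Measure ℝ).prod volume from rfl,
            Measure.prod_prod, Real.volume_Ioc, ← ENNReal.ofReal_mul (by linarith [Real.pi_pos])]
          congr 1; ring
      _ ≤ ENNReal.ofReal (max C₁ C₂ * s ^ (1 / 2 : ℝ)) := by
          refine ENNReal.ofReal_le_ofReal ?_
          rw [← hsqrt]
          have hss : Real.sqrt s₀ ≤ Real.sqrt s := Real.sqrt_le_sqrt hlarge.le
          have hs0 : 0 < Real.sqrt s₀ := Real.sqrt_pos.2 hs₀pos
          calc 4 * π ^ 2 = C₂ * Real.sqrt s₀ := by rw [hC₂, div_mul_cancel₀ _ hs0.ne']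
            _ ≤ C₂ * Real.sqrt s := by gcongr
            _ ≤ max C₁ C₂ * Real.sqrt s := by gcongr; exact le_max_right _ _

end Literature.MathematicalPhysics.QuantumLattice

end
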